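import Summits.HodgeConjecture.HodgeConjecture.Theses.NoetherLefschetzOneUp
import Summits.HodgeConjecture.HodgeConjecture.Theses.CurveNetMordellWeil
import Summits.HodgeConjecture.HodgeConjecture.Theorems.NoetherLefschetzOneUpSummitGrantedFourfoldsSketchSector
import Summits.HodgeConjecture.HodgeConjecture.Theorems.NoetherLefschetzOneUpSummitGrantedFourfoldsStubPencilStepCodim
import Literature.AlgebraicGeometry.HodgeTheory.HardLefschetzNFoldHolds

/-!
# Skeleton of the crux `SummitGrantedFourfolds` (stmt-HodgeConjecture-14600), line `Sketch`, lead c3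
# ("one-sided diagonal — Bloch–Srinivas one level up", reshaped: heart coniveau + the reach of HC(4;2,2))

Crux `stmt-HodgeConjecture-14600` of route `NoetherLefschetzOneUp` (rank 4), shared verbatim with route
`CurveNetMordellWeil` (rank 5):

  `SummitGrantedFourfolds := HC(4;2,2) → ∀ n X, IsSmoothProjective n X →
     Nonempty (HodgeModel n X) ∧ ∀ p c, IsRationalClass c → IsOfHodgeType n X (2p) p p c →
       c ∈ algebraicClasses X p`     (`≡ HC(4;2,2) → HodgeConjecture`, `Iff.rfl`).

THE LINE (idea card `Cruxes/SummitGrantedFourfolds/Ideas/one-sided-diagonal.md`; leads c1/c2 landed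
p149073, p149630, p150897, p153934, p154055, p154529). By the tree's level-wise reduction
(`Theorems.hodgeConjecture_iff_heart`: `HodgeConjecture ↔ MiddleStepFor (¬ ChowZeroDegenerate ·)`, the
CH₀-degenerate regime `Theorems.middleStepChowDegenerate_holds` — Voisin II Prop. 10.26 in every even
dimension — being a THEOREM of the tree) and lead c2's `Theorems.summitGrantedFourfolds_iff_heartFromThree`,
the crux IS, losslessly, the heart of the middle step from level 3 on: for `q ≥ 3` and `X` a smooth
projective `2q`-fold whose `CH₀` is not degenerate, HC in all dimensions `< 2q` ⟹ rational
`(q,q)`-classes on `X` are algebraic.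

RESHAPE (lead c3). Lead c2's open stub asked for a one-sided Hodge-fixing PAIR of correspondences
`k • c = [Z']^* c + [Z'']^* c` over an arbitrary Gysin formalism `G` — a rigid format (for abstract `G`
no action `[Z]^*` is computable but `[Δ_X]^* = id`), of which the composition consumed only the
consequence "`c` is algebraic". The transfer is now the tree's Deligne descent
(`Theorems.supportedHodgeClasses_algebraic_of_hodgeBelowDim`: a rational `(q,q)`-class of coniveau `≥ 1`
is algebraic given HC below), and the open stub is the honest residual in SUPPORT form:

* `stub_heartConiveauOne` (OPEN — the declared open boundary, general Weil-type abelian sixfolds, sits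
  here): `q ≥ 3`, `X` smooth projective of dimension `2q` with `CH₀(X)` not degenerate, HC below `2q` ⟹
  every rational `(q,q)`-class on `X` has coniveau `≥ 1` (dies off a proper Zariski-closed subset).
  HC-true (`algebraicClasses X q = N^q ≤ N^1`), so not stronger than the summit.
* `stub_pencilStepCodim` (PROVABLE NOW — the tree's pencil step `mem_algebraicClasses_of_two_mul_le`,
  de Cataldo–Migliorini Prop. 4.5 / Thomas Prop. 2, with its hypothesis TRUNCATED to codimension `≤ p`,
  which is all its proof `mem_algebraicClasses_of_two_mul_le_of_spread_supports` consumes: HC on the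
  members in codimension `p`, the inductive hypothesis in codimension `< p`).

COMPOSITION `SummitGrantedFourfolds_of` (no `sorry` of its own) exhibits the exact reach of the crux's
hypothesis: from `stub_pencilStepCodim`, HC(4;2,2) gives the Hodge conjecture in CODIMENSION `≤ 2` on
every smooth projective `n`-fold (`hodge_codim_le_two_of_hc42`, induction on `n`; new in tree beyond
`n ≤ 5`), hence by hard Lefschetz in codimension `≥ n - 2` (`hodge_codim_ge_of_hc42`); the open band
`3 ≤ p ≤ n - 3` (first instance `(6;3,3)`) is the heart, i.e. `stub_heartConiveauOne` + descent +
`summitGrantedFourfolds_iff_heartFromThree`.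

## References

* [VoisinHodgeII2003] C. Voisin, Hodge Theory and Complex Algebraic Geometry II, Thm. 10.17,
  Cor. 10.21, Prop. 10.26.
* [DecataldoMigliorini2009] M. A. de Cataldo, L. Migliorini, §4 Prop. 4.5 and its proof.
* [Thomas2005Nodes] R. P. Thomas, Nodes and the Hodge conjecture, §2 Prop. 2.
* [DeligneHodgeIII1974] P. Deligne, Théorie de Hodge III, Cor. 8.2.8.
* [KerrPearlstein2011] M. Kerr, G. Pearlstein, §3.1 (reduction to the middle dimension).
* [Deligne2000] P. Deligne, The Hodge conjecture, Clay (2000), §1.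
-/

set_option linter.dupNamespace false

noncomputable section

namespace Summit.HodgeConjecture.HodgeConjecture.Cruxes.SummitGrantedFourfolds.Sketch

open CategoryTheory AlgebraicGeometry
open Literature.AlgebraicGeometry Literature.AlgebraicGeometry.Motives
  Literature.AlgebraicGeometry.HodgeTheory
open Summit.HodgeConjecture.HodgeConjecture.Theorems
open Summit.HodgeConjecture.HodgeConjecture.Theorems.RegimeSplit

/-- **Stub 1 — the pencil step below the middle, codimension-truncated — LANDED p156883, `Theorems.stub_pencilStepCodim`.** If on every
smooth projective complex `m`-fold every rational `(q,q)`-class of codimension `q ≤ p` is algebraic,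
then on every smooth projective complex `(m+1)`-fold `X` every rational `(p,p)`-class with `2p ≤ m`
is algebraic. The tree's `mem_algebraicClasses_of_two_mul_le_of_spread_supports` (Lefschetz pencil,
HC on the smooth members IN CODIMENSION `p`, spreading of the fibrewise supports
`spread_supports_over_projectiveLine_holds`, vertical support lines, descent of the generators by the
inductive hypothesis IN CODIMENSION `p - 1`, hard Lefschetz) proves exactly this: its hypothesis is
consulted only in codimensions `≤ p`.
[cite: DecataldoMigliorini2009, §4 Prop. 4.5 and its proof (arXiv:0711.1307v1 pp. 10–11)]
[cite: Thomas2005Nodes, §2 Prop. 2 and its proof, case k < d/2] -/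
theorem stub_pencilStepCodim :
    ∀ ⦃m : ℕ⦄ ⦃X : Literature.AlgebraicGeometry.Motives.SchemeOver ℂ⦄,
      Literature.AlgebraicGeometry.Motives.IsSmoothProjective (m + 1) X → ∀ (p : ℕ),
      (∀ ⦃Y : Literature.AlgebraicGeometry.Motives.SchemeOver ℂ⦄,
          Literature.AlgebraicGeometry.Motives.IsSmoothProjective m Y → ∀ q : ℕ, q ≤ p →
          ∀ c : Literature.AlgebraicGeometry.HodgeTheory.complexBetti Y (2 * q),
            Literature.AlgebraicGeometry.HodgeTheory.IsRationalClass c →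
            Literature.AlgebraicGeometry.HodgeTheory.IsOfHodgeType m Y (2 * q) q q c →
            c ∈ Literature.AlgebraicGeometry.HodgeTheory.algebraicClasses Y q) →
      2 * p ≤ m → ∀ c : Literature.AlgebraicGeometry.HodgeTheory.complexBetti X (2 * p),
        Literature.AlgebraicGeometry.HodgeTheory.IsRationalClass c →
        Literature.AlgebraicGeometry.HodgeTheory.IsOfHodgeType (m + 1) X (2 * p) p p c →
        c ∈ Literature.AlgebraicGeometry.HodgeTheory.algebraicClasses X p :=
  -- LANDED p156883 (wave 1): `Theorems/NoetherLefschetzOneUpSummitGrantedFourfoldsStubPencilStepCodim.lean`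
  _root_.Summit.HodgeConjecture.HodgeConjecture.Theorems.stub_pencilStepCodim

/-- **Stub 2 — coniveau one on the heart, from level 3 on (OPEN).** For `q ≥ 3` and `X` smooth
projective of dimension `2q` over `ℂ` whose `CH₀` is NOT degenerate (`¬ RegimeSplit.ChowZeroDegenerate X`:
no proper closed `W ⊊ X` carries all `0`-cycles up to rational equivalence — the regime
`h^{2q,0} ≠ 0` by Mumford–Roitman), granted the Hodge conjecture in all dimensions `< 2q`: every
rational `(q,q)`-class on `X` has coniveau `≥ 1`, i.e. lies in `N¹ H^{2q}(X(ℂ); ℂ)` (dies off a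
proper Zariski-closed subset). A consequence of the Hodge conjecture for `X`
(`algebraicClasses X q = N^q H^{2q} ≤ N¹ H^{2q}`); by Deligne descent it gives the heart of the middle
step. The general Weil-type abelian sixfold (`q = 3`) is the first open case.
[cite: VoisinHodgeII2003, Thm. 10.17] [cite: DeligneHodgeIII1974, Cor. 8.2.8] [cite: Deligne2000, §1] -/
theorem stub_heartConiveauOne :
    ∀ ⦃q : ℕ⦄ ⦃X : Literature.AlgebraicGeometry.Motives.SchemeOver ℂ⦄, 3 ≤ q →
      Literature.AlgebraicGeometry.Motives.IsSmoothProjective (2 * q) X →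
      Summit.HodgeConjecture.HodgeConjecture.Theorems.RegimeSplit.HodgeBelowDim (2 * q) →
      ¬ Summit.HodgeConjecture.HodgeConjecture.Theorems.RegimeSplit.ChowZeroDegenerate X →
      ∀ c : Literature.AlgebraicGeometry.HodgeTheory.complexBetti X (2 * q),
        Literature.AlgebraicGeometry.HodgeTheory.IsRationalClass c →
        Literature.AlgebraicGeometry.HodgeTheory.IsOfHodgeType (2 * q) X (2 * q) q q c →
        c ∈ Literature.AlgebraicGeometry.HodgeTheory.supportedClasses X (2 * q) 1 := by
  sorry

/-! ### The reach of HC(4;2,2): codimension `≤ 2` and `≥ n - 2` in every dimension -/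

/-- **Granted HC(4;2,2), the Hodge conjecture holds in codimension `≤ 2` on every smooth projective
complex variety of every dimension** (from `stub_pencilStepCodim`, by induction on the dimension:
dimension `≤ 3` is the tree's `hodgeBelowDim_four`, dimension `4` is `algebraicClasses_zero` /
Lefschetz `(1,1)` / the hypothesis, dimension `m + 1 ≥ 5` is the truncated pencil step, `2·2 ≤ m`).
[cite: Thomas2005Nodes, §2 Prop. 2] [cite: DecataldoMigliorini2009, §4 Prop. 4.5] -/
theorem hodge_codim_le_two_of_hc42
    (h42 : ∀ ⦃X : SchemeOver ℂ⦄, IsSmoothProjective 4 X → ∀ c : complexBetti X (2 * 2),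
      IsRationalClass c → IsOfHodgeType 4 X (2 * 2) 2 2 c → c ∈ algebraicClasses X 2) :
    ∀ (n : ℕ) ⦃X : SchemeOver ℂ⦄, IsSmoothProjective n X → ∀ p : ℕ, p ≤ 2 →
      ∀ c : complexBetti X (2 * p), IsRationalClass c → IsOfHodgeType n X (2 * p) p p c →
        c ∈ algebraicClasses X p := by
  intro n
  induction n using Nat.strong_induction_on with
  | _ n ihn =>
  intro X hX p hp c hc hh
  rcases Nat.lt_or_ge n 4 with h4 | h4
  · exact hodgeBelowDim_four h4 hX p c hc hh
  rcases Nat.lt_or_ge n 5 with h5 | h5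
  · obtain rfl : n = 4 := by omega
    interval_cases p
    · rw [algebraicClasses_zero]
      exact Submodule.mem_top
    · exact lefschetzOneOne_rational_holds hX c hc hh
    · exact h42 hX c hc hh
  · obtain ⟨m, rfl⟩ : ∃ m, n = m + 1 := ⟨n - 1, by omega⟩
    exact stub_pencilStepCodim hX p
      (fun Y hY q hq c' hc' hh' ↦ ihn m (lt_add_one m) hY q (hq.trans hp) c' hc' hh') (by omega) c hc hh

/-- **Granted HC(4;2,2), the Hodge conjecture holds in codimension `p ≥ n - 2` on every smooth
projective complex `n`-fold**: for `2p ≤ n` this forces `p ≤ 2` (`hodge_codim_le_two_of_hc42`); for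
`n < 2p` hard Lefschetz (`HardLefschetzNFold.mem_algebraicClasses_of_lt_holds`) reduces to codimension
`n - p ≤ 2`. [cite: KerrPearlstein2011, §3.1] [cite: VoisinHodgeI2002, Thm. 6.25] -/
theorem hodge_codim_ge_of_hc42
    (h42 : ∀ ⦃X : SchemeOver ℂ⦄, IsSmoothProjective 4 X → ∀ c : complexBetti X (2 * 2),
      IsRationalClass c → IsOfHodgeType 4 X (2 * 2) 2 2 c → c ∈ algebraicClasses X 2)
    {n : ℕ} {X : SchemeOver ℂ} (hX : IsSmoothProjective n X) (p : ℕ) (hnp : n ≤ p + 2)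
    (c : complexBetti X (2 * p)) (hc : IsRationalClass c) (hh : IsOfHodgeType n X (2 * p) p p c) :
    c ∈ algebraicClasses X p := by
  rcases Nat.lt_or_ge n (2 * p) with hlt | hge
  · exact HardLefschetzNFold.mem_algebraicClasses_of_lt_holds hX hlt
      (fun c' hc' hh' ↦ hodge_codim_le_two_of_hc42 h42 n hX (n - p) (by omega) c' hc' hh') c hc hh
  · exact hodge_codim_le_two_of_hc42 h42 n hX p (by omega) c hc hh

/-! ### The heart from coniveau one -/

/-- **The heart of the middle step from level 3 on, from `stub_heartConiveauOne`**: a rational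
`(q,q)`-class of coniveau `≥ 1` is algebraic given HC below (Deligne descent,
`Theorems.supportedHodgeClasses_algebraic_of_hodgeBelowDim`). [cite: DeligneHodgeIII1974, Cor. 8.2.8]
[cite: Voisin2025, Cor. 2.12] -/
theorem heartFromThree_of_stub :
    ∀ ⦃q : ℕ⦄ ⦃X : SchemeOver ℂ⦄, 3 ≤ q → IsSmoothProjective (2 * q) X → HodgeBelowDim (2 * q) →
      ¬ ChowZeroDegenerate X → ∀ c : complexBetti X (2 * q), IsRationalClass c →
        IsOfHodgeType (2 * q) X (2 * q) q q c → c ∈ algebraicClasses X q :=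
  fun _ _ hq hX ih hnd c hc hh ↦
    supportedHodgeClasses_algebraic_of_hodgeBelowDim ih hX c hc hh
      (stub_heartConiveauOne hq hX ih hnd c hc hh)

/-! ### The composition -/

/-- **The crux from its two registered stubs, BY NAME** (composition; no `sorry` of its own).
Granted HC(4;2,2): Hodge models exist unconditionally (`nonempty_hodgeModel_holds`); in codimension
`p ≤ 2` the class is algebraic by `hodge_codim_le_two_of_hc42` (`stub_pencilStepCodim`), in
codimension `p ≥ n - 2` by `hodge_codim_ge_of_hc42`; in the band `3 ≤ p ≤ n - 3` by the heart:
`summitGrantedFourfolds_iff_heartFromThree.2` fed with `heartFromThree_of_stub`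
(`stub_heartConiveauOne` + Deligne descent). [cite: KerrPearlstein2011, §3.1]
[cite: VoisinHodgeII2003, Prop. 10.26 and Thm. 10.17] [cite: Deligne2000, §1] -/
theorem SummitGrantedFourfolds_of :
    Summit.HodgeConjecture.HodgeConjecture.Theses.NoetherLefschetzOneUp.SummitGrantedFourfolds := by
  unfold Summit.HodgeConjecture.HodgeConjecture.Theses.NoetherLefschetzOneUp.SummitGrantedFourfolds
  intro h42 n X hX
  refine ⟨(nonempty_hodgeModel_holds (n := n) (X := X)).nonempty hX, fun p c hc hh ↦ ?_⟩
  by_cases hp : p ≤ 2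
  · -- the reach of HC(4;2,2): codimension ≤ 2
    exact hodge_codim_le_two_of_hc42 h42 n hX p hp c hc hh
  by_cases hn : n ≤ p + 2
  · -- the reach of HC(4;2,2): codimension ≥ n - 2
    exact hodge_codim_ge_of_hc42 h42 hX p hn c hc hh
  · -- the open band 3 ≤ p ≤ n - 3: the heart of the middle step from level 3 on
    exact ((summitGrantedFourfolds_iff_heartFromThree.2 heartFromThree_of_stub) h42 hX).2 p c hc hh

/-- The same theorem for the verbatim-shared decl of route `CurveNetMordellWeil` (rank 5): the two
route decls are syntactically identical. [cite: Deligne2000, §1] -/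
theorem SummitGrantedFourfolds_of' :
    Summit.HodgeConjecture.HodgeConjecture.Theses.CurveNetMordellWeil.SummitGrantedFourfolds :=
  SummitGrantedFourfolds_of

end Summit.HodgeConjecture.HodgeConjecture.Cruxes.SummitGrantedFourfolds.Sketch

end
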